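import Literature.Analysis.OperatorTheory.Enflo2023.CaseIIBranch
import HarnessLib

/-!
# Enflo (2023), Part A, v2 p.13 — the aligned regime EXITS Case II at the next stage

[cite: Enflo2023, v2 p.12 L390–L400 (Case I / Case II), p.13 L406–L443 ((26), the factor, the branch)]

WHAT IS PROVED.  `CaseIIFactor.factor_false_for_minimal` / `factor_false_satisfiable` exhibit (in `ℂ³`) a
stage `y` of the (26)-iteration at which the text's Case II holds EXACTLY and the text's factor
`(εθ)' < (1 − 1/20)εθ` FAILS for THE minimal solution `ℓ'`.  `CaseIIBranch.factor_of_caseII_twice`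
shows that Case II (as printed, `≤ (εθ)⁴`, `j ≥ 1`) at `y` AND at `y' = ℓ'(T)y` forces
`(εθ)' ≤ 0.9491εθ`.  Putting the two together (pure logic, no new analysis):

* `next_not_caseII_printed_of_factor_fails` — at a Case II stage where the factor fails, the next
  iterate `ℓ'(T)y` is NOT Case II as printed, i.e. (`exists_caseI_next_of_factor_fails`) some
  `j ≥ 1` has `|⟨x₀ − y', T^j y'⟩| > ((εθ)')⁴` — the text's Case I at the next stage;
* `aligned_witness_exits_caseII` — the `ℂ³` witness of `factor_false_satisfiable` is such a stage:
  all hypotheses of the branch hold at `y`, the factor fails, and the next iterate is Case I.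

* `run_unique`, `caseI_exit_or_hasNontrivialClosedInvariantSubspace` — runs of (26) are unique
  (THE minimal solution is unique at each stage), hence the END-OF-p.13 DICHOTOMY for THE run from
  `y₀`: either some stage has a Case I index, or `T` has a non-trivial closed invariant subspace
  (packaging of `CaseIIBranch.hasNontrivialClosedInvariantSubspace_of_caseII_along_runs`).

So along the manuscript's "Case II happens every time" branch (tex L443) the aligned regime of
`factor_false_for_minimal` cannot persist: it is left through Case I one stage later.  This is the
kernel form of REPAIR-CENSUS row F1-V8 (b)(iii) / RF-2 of the pub-enflo packet.  It is a statement
about the manuscript's own iteration, NOT progress on the invariant subspace problem.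
-/

noncomputable section

open scoped InnerProductSpace

namespace Literature.Analysis.OperatorTheory.Enflo2023

namespace CaseII

open Vy

section General

variable {H : Type*} [NormedAddCommGroup H] [InnerProductSpace ℂ H] [CompleteSpace H]

/-- If at a Case II stage (as printed, `j ≥ 1`, `≤ (εθ)⁴`) the text's factor `(εθ)' < (1 − 1/20)εθ`
fails for THE minimal solution of (26), then the next iterate is not Case II as printed.
[cite: Enflo2023, v2 p.12 L400, p.13 L421–L443] -/
theorem next_not_caseII_printed_of_factor_fails (T : H →L[ℂ] H) (hT1 : ‖T‖ < 1)
    (hT : ‖T‖ ≤ 1 / 10 ^ 20) (x₀ y : H) (et : ℝ) (a : ℓ2)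
    (h0 : ‖x₀‖ = 1) (ht : ⟪x₀ - y, y⟫_ℂ = et) (het : 0 < et) (het1 : et ≤ 1 / 10 ^ 4)
    (hd : ‖x₀ - y‖ ≤ 0.7) (hII : ∀ j, 1 ≤ j → ‖⟪x₀ - y, (T ^ j) y⟫_ℂ‖ ≤ et ^ 4)
    (hmin : IsMinimal (V T hT1 y) x₀ ‖x₀ - ((1 + et / 10 : ℝ) : ℂ) • y‖ a)
    (hfail : (1 - 1 / 20) * et ≤ (⟪x₀ - V T hT1 y a, V T hT1 y a⟫_ℂ).re) :
    ¬ (∀ j, 1 ≤ j → ‖⟪x₀ - V T hT1 y a, (T ^ j) (V T hT1 y a)⟫_ℂ‖ ≤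
        (⟪x₀ - V T hT1 y a, V T hT1 y a⟫_ℂ).re ^ 4) := by
  intro hII'
  have h := factor_of_caseII_twice T hT1 hT x₀ y et a h0 ht het het1 hd hII hmin hII'
  linarith

/-- The same, positively: some `j ≥ 1` is a Case I index at the next stage.
[cite: Enflo2023, v2 p.12 L390 (Case I), p.13 L421–L443] -/
theorem exists_caseI_next_of_factor_fails (T : H →L[ℂ] H) (hT1 : ‖T‖ < 1)
    (hT : ‖T‖ ≤ 1 / 10 ^ 20) (x₀ y : H) (et : ℝ) (a : ℓ2)
    (h0 : ‖x₀‖ = 1) (ht : ⟪x₀ - y, y⟫_ℂ = et) (het : 0 < et) (het1 : et ≤ 1 / 10 ^ 4)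
    (hd : ‖x₀ - y‖ ≤ 0.7) (hII : ∀ j, 1 ≤ j → ‖⟪x₀ - y, (T ^ j) y⟫_ℂ‖ ≤ et ^ 4)
    (hmin : IsMinimal (V T hT1 y) x₀ ‖x₀ - ((1 + et / 10 : ℝ) : ℂ) • y‖ a)
    (hfail : (1 - 1 / 20) * et ≤ (⟪x₀ - V T hT1 y a, V T hT1 y a⟫_ℂ).re) :
    ∃ j, 1 ≤ j ∧ (⟪x₀ - V T hT1 y a, V T hT1 y a⟫_ℂ).re ^ 4 <
        ‖⟪x₀ - V T hT1 y a, (T ^ j) (V T hT1 y a)⟫_ℂ‖ := by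
  by_contra hcon
  refine next_not_caseII_printed_of_factor_fails T hT1 hT x₀ y et a h0 ht het het1 hd hII hmin
    hfail (fun j hj => ?_)
  exact not_lt.1 (fun hlt => hcon ⟨j, hj, hlt⟩)

/-- Runs of (26) from a given start are UNIQUE: at every stage THE minimal solution is unique
(`IsMinimal.unique`), so two runs from `y₀` coincide stage by stage.
[cite: Enflo2023, v2 p.2 (1) (minimal `‖ℓ‖₂`), p.13 (26)] -/
theorem run_unique (T : H →L[ℂ] H) (hT : ‖T‖ < 1) (x₀ y₀ : H) (y y' : ℕ → H) (a a' : ℕ → ℓ2)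
    (hy0 : y 0 = y₀)
    (hy : ∀ n, IsMinimal (V T hT (y n)) x₀ ‖x₀ - ((1 + (⟪x₀ - y n, y n⟫_ℂ).re / 10 : ℝ) : ℂ) • y n‖ (a n) ∧
      y (n + 1) = V T hT (y n) (a n))
    (hy0' : y' 0 = y₀)
    (hy' : ∀ n, IsMinimal (V T hT (y' n)) x₀ ‖x₀ - ((1 + (⟪x₀ - y' n, y' n⟫_ℂ).re / 10 : ℝ) : ℂ) • y' n‖ (a' n) ∧
      y' (n + 1) = V T hT (y' n) (a' n)) :
    ∀ n, y' n = y n ∧ a' n = a n := by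
  intro n
  induction n with
  | zero =>
    have h0 : y' 0 = y 0 := by rw [hy0, hy0']
    refine ⟨h0, ?_⟩
    have h1 := (hy' 0).1
    rw [h0] at h1
    exact ((hy 0).1.unique h1).symm
  | succ n ih =>
    have h1' : y' (n + 1) = y (n + 1) := by rw [(hy' n).2, (hy n).2, ih.1, ih.2]
    refine ⟨h1', ?_⟩
    have h1 := (hy' (n + 1)).1
    rw [h1'] at h1
    exact ((hy (n + 1)).1.unique h1).symm

/-- THE END-OF-p.13 DICHOTOMY, secured: along THE run of (26) from `y₀` (`‖T‖ ≤ 10⁻²⁰`, `‖x₀‖ = 1`,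
`0.3 ≤ ‖x₀ − y₀‖ ≤ 0.7`, `(εθ)₀ ∈ [0, 10⁻⁴]` real), EITHER some stage `n` has a Case I index
(`|⟨x₀ − y_n, T^j y_n⟩| > ((εθ)_n)⁴` for some `j ≥ 1`) OR `T` has a non-trivial closed invariant
subspace ("if Case II happens every time we obtain convergence to a non-cyclic vector").  No (27),
no contraction hypothesis.  [cite: Enflo2023, v2 p.12 L386–L400, p.13 L406–L443] -/
theorem caseI_exit_or_hasNontrivialClosedInvariantSubspace (T : H →L[ℂ] H) (hT : ‖T‖ < 1)
    (hT20 : ‖T‖ ≤ 1 / 10 ^ 20) (x₀ y₀ : H) (hx₀ : ‖x₀‖ = 1)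
    (hwin : 0.3 ≤ ‖x₀ - y₀‖ ∧ ‖x₀ - y₀‖ ≤ 0.7) (him : (⟪x₀ - y₀, y₀⟫_ℂ).im = 0)
    (ht0 : 0 ≤ (⟪x₀ - y₀, y₀⟫_ℂ).re) (ht1 : (⟪x₀ - y₀, y₀⟫_ℂ).re ≤ 1 / 10 ^ 4)
    (y : ℕ → H) (a : ℕ → ℓ2) (hy0 : y 0 = y₀)
    (hy : ∀ n, IsMinimal (V T hT (y n)) x₀ ‖x₀ - ((1 + (⟪x₀ - y n, y n⟫_ℂ).re / 10 : ℝ) : ℂ) • y n‖ (a n) ∧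
      y (n + 1) = V T hT (y n) (a n)) :
    (∃ n j, 1 ≤ j ∧ (⟪x₀ - y n, y n⟫_ℂ).re ^ 4 < ‖⟪x₀ - y n, (T ^ j) (y n)⟫_ℂ‖) ∨
      HasNontrivialClosedInvariantSubspace T := by
  rw [or_iff_not_imp_left]
  intro hno
  refine hasNontrivialClosedInvariantSubspace_of_caseII_along_runs T hT hT20 x₀ y₀ hx₀ hwin him ht0 ht1 ?_
  intro y' a' hy0' hy' n j hj
  obtain ⟨hyn, -⟩ := run_unique T hT x₀ y₀ y y' a a' hy0 hy hy0' hy' n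
  rw [hyn]
  exact not_lt.1 (fun hlt => hno ⟨n, j, hj, hlt⟩)

end General

section Model

/-- The `ℂ³` witness of `factor_false_satisfiable` (exact Case II at `y`, alignment, `εθ = 10⁻⁵⁰`,
`‖T‖ ≤ 10⁻²⁰`) exits Case II at the next stage: the factor fails at `y` and the next iterate
`ℓ'(T)y` has a Case I index.  [cite: Enflo2023, v2 p.12 L390–L400, p.13 L406–L443] -/
theorem aligned_witness_exits_caseII :
    ∃ (T : EuclideanSpace ℂ (Fin 3) →L[ℂ] EuclideanSpace ℂ (Fin 3)) (hT1 : ‖T‖ < 1)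
      (x₀ y : EuclideanSpace ℂ (Fin 3)) (et : ℝ) (a : Vy.ℓ2),
      ‖T‖ ≤ 1 / 10 ^ 20 ∧ ‖x₀‖ = 1 ∧ ⟪x₀ - y, y⟫_ℂ = (et : ℂ) ∧ 0 < et ∧ et ≤ 1 / 10 ^ 4 ∧
      ‖x₀ - y‖ ≤ 0.7 ∧ (∀ j, 1 ≤ j → ⟪x₀ - y, (T ^ j) y⟫_ℂ = 0) ∧
      IsMinimal (Vy.V T hT1 y) x₀ ‖x₀ - ((1 + et / 10 : ℝ) : ℂ) • y‖ a ∧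
      (1 - 1 / 20) * et < (⟪x₀ - Vy.V T hT1 y a, Vy.V T hT1 y a⟫_ℂ).re ∧
      ∃ j, 1 ≤ j ∧ (⟪x₀ - Vy.V T hT1 y a, Vy.V T hT1 y a⟫_ℂ).re ^ 4 <
        ‖⟪x₀ - Vy.V T hT1 y a, (T ^ j) (Vy.V T hT1 y a)⟫_ℂ‖ := by
  obtain ⟨T, hT1, x₀, y, et, a, hT, h0, ht, het0, het1, hd, hII, hmin, -, hfail⟩ :=
    factor_false_satisfiable
  have het : 0 < et := lt_of_lt_of_le (by norm_num) het0
  have hII4 : ∀ j, 1 ≤ j → ‖⟪x₀ - y, (T ^ j) y⟫_ℂ‖ ≤ et ^ 4 := fun j hj => by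
    rw [hII j hj, norm_zero]; exact pow_nonneg het.le 4
  exact ⟨T, hT1, x₀, y, et, a, hT, h0, ht, het, het1, hd, hII, hmin, hfail,
    exists_caseI_next_of_factor_fails T hT1 hT x₀ y et a h0 ht het het1 hd hII4 hmin hfail.le⟩

end Model

end CaseII

end Literature.Analysis.OperatorTheory.Enflo2023

end
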